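import Summits.Parity.GeneralizedHardyLittlewood.Theorems.LeeYangFibresRelativeDimOneFloatingPairSumModel
import Summits.Parity.GeneralizedHardyLittlewood.Theorems.LeeYangFibresRelativeDimOneFloatingPairMassTransfer
import Summits.Parity.GeneralizedHardyLittlewood.Theorems.LeeYangFibresRelativeDimOneFloatingExcParseval
import Summits.Parity.GeneralizedHardyLittlewood.Theorems.LeeYangFibresRelativeDimOneFloatingSiegelSecondMoment
import Summits.Parity.GeneralizedHardyLittlewood.Theorems.LeeYangFibresRelativeDimOneFloatingSiegelEndgame
import Summits.Parity.GeneralizedHardyLittlewood.Theorems.LeeYangFibresRelativeDimOneFloatingCalibrationFree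
import Literature.Barriers.Parity.SiegelZeroDichotomyNoSiegelZeros
import Literature.NumberTheory.LFunctions.SiegelZeroQualityBound
import Mathlib.NumberTheory.Primorial
import HarnessLib

/-!
# Route `LeeYangFibres`, crux `RelativeDimOne` (stmt-Parity-14113), line `floating-level-core` (lead seat c5):
# THE DEBT-FREE SIEGEL STEP AND THE DEBT-FREE CALIBRATION —
# `IncidenceBandlimitedCoreDecay θ → ¬UnboundedSiegelZeros` and `RelativeDimOne ↔ IncidenceBandlimitedCoreDecay (1/4)`,
# with NO literature debt

On arrival of lead c5 the line proved `RelativeDimOne ↔ IncidenceBandlimitedCoreDecay (1/4)` modulo ONE theorem in print,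
Matomäki–Merikoski 2023 Thm 1.3 (vendored fact `MatomakiMerikoski2023_pairCorrelation`, registered stub `stub_pairCorrelation`,
formalisation XL), consumed once: by (B) `stub_siegelRepulsion`, for the TRUE pair asymptotics under an exceptional zero at the
shifts `2q`, `h₂`; and lead c4 had made the NECESSITY side debt-free (`RelativeDimOne ↔ P′(1/4) ∧ NoSiegelZeros`,
`relativeDimOne_iff_core_of_coreImpliesNSZ` isolating the single missing implication `P′(1/4) → NoSiegelZeros`). This file proves
that implication unconditionally — the reshaped skeleton `Cruxes/RelativeDimOne/Lines/floating_level_core.lean` (c5) composed BY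
NAME from its five landed stubs:

* (M) `stub_pairSumModel` (`…FloatingPairSumModel.lean`): under P′ the pair sums `S_N(h) = Σ_{n ≤ N−h} Λ(n)Λ(n+h)` are
  `(N − h) g(h) ± ε(N h/φ(h) + N)` for a bounded function `g` of the prime divisors `p ≤ w = ⌊log₄N⌋/D` of `h` (core clause at
  `(n, n+h)` on `[-(N−h), N−h]`, type rigidity R1, decay);
* (T) `stub_pairMassTransfer` (`…FloatingPairMassTransfer.lean`): two moduli `m₁, m₂ ≤ N^{1/4}` with the same prime divisors `≤ w`
  have the same normalised lattice mass `m · pairMass N m / N²` up to `δ(m₁/φ(m₁) + m₂/φ(m₂))`, `pairMass N m = 2Σ_{k ≤ N/m} S_N(mk)`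
  being the off-diagonal of Gallagher's identity `Σ_{a mod m} ψ(N;m,a)² = ΣΛ² + pairMass N m` (`sum_classPsi_sq_eq_pairMass`);
* (P) `stub_excParsevalLower` (`…FloatingExcParseval.lean`): `ψ_cop(N)² + ‖ψ(N,χ)‖² ≤ φ(q) Σ_a ψ(N;q,a)²`;
* (S) `stub_siegelSecondMoment` (`…FloatingSiegelSecondMoment.lean`): with a Siegel zero `(χ mod q, η)` present, the class second
  moment to every modulus `d ≤ N^{θ₁}` with `q ∤ d` is `≤ (1+ε)(N²/φ(d) + N log N)` in the window `θ₁ log N ≤ c η log q` (the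
  tree's UNCONDITIONAL `gallagher_nonexceptional`, exceptional clause, + Parseval);
* (E) `stub_siegelEndgame` (`…FloatingSiegelEndgame.lean`): no Siegel zero of large quality admits `‖ψ(u,χ)‖ ≤ u/40` throughout
  `[q^A, q^{2A}]` (Tao–Teräväinen Prop. 3.5 + Mertens I + Chebyshev + Abel).

THE ARGUMENT (`siegelRepulsion_free`). Suppose P′(θ) and Siegel zeros of unbounded quality. Fix the accuracy `e = 1/20000`, the
level `θ₁(e)` and window constant `c` of (S), `A = max(4, ⌈1/θ₁⌉)`, `D = 2A + 1`, the thresholds of (T), of the prime number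
theorem and of `N^{1/2}, N^{1/4} log N = o(N)`; take a Siegel zero of quality `η ≥ max(η₂(A), 2Aθ₁/c)` at a conductor `q` beyond
all thresholds. For `u = N ∈ [q^A, q^{2A}]`: `q ≤ N^{1/A} ≤ N^{θ₁}, N^{1/4}`, the window holds, and the comparison modulus
`d = ∏_{p ∣ q, p ≤ w} p` satisfies `d ∣ q`, `d ≤ 4^w`, `(4^w)^{2A+1} ≤ N ≤ q^{2A}` so `d < q`, `q ∤ d`, and `p ∣ q ↔ p ∣ d` for primes
`p ≤ w`. (S) at `d` and Gallagher: `d·pairMass N d/N² ≤ (1+e) d/φ(d) + 2e`; (T): `q·pairMass N q/N² ≤ (1+5e) q/φ(q)`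
(`d/φ(d) ≤ q/φ(q)`); Gallagher at `q`, `ΣΛ² ≤ (1+e)N log N`, `φ(q) ≤ N^{1/4}`: `φ(q)Σ_a ψ(N;q,a)² ≤ (1+6e)N²`; PNT and the
non-coprime classes (`≤ 3√N log N`): `ψ_cop ≥ (1−2e)N`; (P): `‖ψ(N,χ)‖² ≤ 10e N² ≤ (N/40)²`. (E) is contradicted.

CONSEQUENCES (all sorry-free, no vendored fact anywhere in the cone): `noSiegelZeros_of_coreDecay_free : P′(θ) → NoSiegelZeros`;
THE DEBT-FREE CALIBRATION `relativeDimOne_iff_core_free : RelativeDimOne ↔ IncidenceBandlimitedCoreDecay (1/4)` (and `_at` every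
`0 < θ < 1`) — the crux stmt-Parity-14113 IS its parity atom, a single typed statement, with no literature debt; the `L`-content
(`LowClassSecondMoment θ₁`, `UniformCharPNT`) and rh.S34 are consequences of P′ alone; and the hardness certificate
`not_coreDecay_of_unboundedSiegelZeros : UnboundedSiegelZeros → ¬ IncidenceBandlimitedCoreDecay θ` for every line feeding P′
(cruxes 14108 / 14109 / 14113).

References: Gallagher, Mathematika 23 (1976) §2 [Gallagher1976]; Gallagher, Invent. Math. 11 (1970), Thm 7 [Gallagher1970];
Montgomery–Vaughan, Acta Arith. 27 (1975), Lemma 4.3 [MontgomeryVaughanActa1975]; Tao–Teräväinen, J. London Math. Soc. 106 (2022),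
Prop. 3.5 [TaoTeravainen2021]; Green–Tao, Ann. of Math. 171 (2010), Conj. 1.4 [GreenTao2010]; Matomäki–Merikoski, IMRN 2023, Thm 1.3
[MatomakiMerikoski2023] (no longer used).
-/

noncomputable section

open scoped BigOperators Classical ArithmeticFunction.vonMangoldt
open Finset Filter Literature.NumberTheory.Sieve Literature.Barriers.Parity
open Literature.NumberTheory.LFunctions (NoSiegelZeros)
open Summit.Parity.GeneralizedHardyLittlewood.Theses.LeeYangFibres (RelativeDimOne)
open Summit.Parity.GeneralizedHardyLittlewood.Cruxes.RelativeDimOne.GallagherBackwards (classPsi charPsi UniformCharPNT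
  uniformCharPNT_of_relativeDimOne sum_vonMangoldt_sq_le_log_mul)
open Summit.Parity.GeneralizedHardyLittlewood.Cruxes.RelativeDimOne.GallagherBackwardsSplit
open Summit.Parity.GeneralizedHardyLittlewood.Cruxes.RelativeDimOne.TypeSplit

namespace Summit.Parity.GeneralizedHardyLittlewood.Cruxes.RelativeDimOne.FloatingLevelCore

/-! ### Tools -/

/-- `d/φ(d) ≤ q/φ(q)` for `d ∣ q`, `q ≠ 0` (`q/φ(q) = ∏_{p ∣ q} p/(p−1)` and the prime factors of `d` are among those
of `q`). -/
theorem cast_div_totient_le_of_dvd {d q : ℕ} (hdq : d ∣ q) (hq : q ≠ 0) :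
    (d : ℝ) / (Nat.totient d : ℝ) ≤ (q : ℝ) / (Nat.totient q : ℝ) := by
  have hd : d ≠ 0 := by
    rintro rfl
    exact hq (zero_dvd_iff.mp hdq)
  rw [← Literature.NumberTheory.Sieve.MontgomeryVaughan1975.prod_primeFactors_div_eq hd,
    ← Literature.NumberTheory.Sieve.MontgomeryVaughan1975.prod_primeFactors_div_eq hq]
  refine Finset.prod_le_prod_of_subset_of_one_le (Nat.primeFactors_mono hdq hq) (fun p hp => ?_) (fun p hp _ => ?_)
  · have hp2 : (2 : ℝ) ≤ p := by exact_mod_cast (Nat.prime_of_mem_primeFactors hp).two_le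
    exact div_nonneg (by linarith) (by linarith)
  · have hp2 : (2 : ℝ) ≤ p := by exact_mod_cast (Nat.prime_of_mem_primeFactors hp).two_le
    rw [le_div_iff₀ (by linarith)]
    linarith

/-! ### The debt-free Siegel step -/

/-- **THE DEBT-FREE SIEGEL STEP (B′)** — the bare parity atom at ANY level `θ > 0` excludes Siegel zeros of unbounded
quality, with NO literature debt: `IncidenceBandlimitedCoreDecay θ → ¬UnboundedSiegelZeros`. Composed BY NAME from the
landed stubs (M) `stub_pairSumModel`, (T) `stub_pairMassTransfer`, (P) `stub_excParsevalLower`, (S) `stub_siegelSecondMoment`,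
(E) `stub_siegelEndgame` (see the module docstring for the argument: Gallagher's identity backwards at the exceptional
conductor `q` and at its `w`-smooth radical `d`). All accuracies are the one constant `1/20000`. Supersedes the landed
`stub_siegelRepulsion` (same conclusion modulo Matomäki–Merikoski 2023, Thm 1.3). -/
theorem siegelRepulsion_free : ∀ θ : ℝ, 0 < θ → IncidenceBandlimitedCoreDecay θ →
    ¬ Literature.Barriers.Parity.UnboundedSiegelZeros := by
  intro θ hθ hP hU
  have hT : PairMassTransfer := stub_pairMassTransfer (stub_pairSumModel θ hθ hP)
  obtain ⟨c, hc, hS⟩ := stub_siegelSecondMoment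
  obtain ⟨θ₁, hθ₁, hθ₁4, N₁, hN₁⟩ := hS (1 / 20000) (by norm_num)
  -- the exponent `A ≥ 4` with `A θ₁ ≥ 1`; conditioning parameter `D = 2A + 1`
  obtain ⟨A, hA4, hAθ⟩ : ∃ A : ℕ, 4 ≤ A ∧ 1 ≤ (A : ℝ) * θ₁ := by
    refine ⟨max 4 ⌈1 / θ₁⌉₊, le_max_left _ _, ?_⟩
    have h1 : 1 / θ₁ ≤ ((max 4 ⌈1 / θ₁⌉₊ : ℕ) : ℝ) :=
      (Nat.le_ceil _).trans (by exact_mod_cast le_max_right 4 ⌈1 / θ₁⌉₊)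
    rw [div_le_iff₀ hθ₁] at h1
    linarith
  have hA0 : (0 : ℝ) < A := by exact_mod_cast (show 0 < A by omega)
  have hAne : A ≠ 0 := by omega
  obtain ⟨η₂, q₂, hE⟩ := stub_siegelEndgame A (by omega)
  obtain ⟨N₂, hN₂⟩ := hT (2 * A + 1) (by omega) (1 / 20000) (by norm_num)
  -- thresholds in `N`
  have hev : ∀ᶠ N : ℕ in atTop,
      ((1 - 1 / 20000) * N ≤ ∑ n ∈ Icc 1 N, Λ n ∧ ∑ n ∈ Icc 1 N, Λ n ≤ (1 + 1 / 20000) * N) ∧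
      (3 * (N : ℝ) ^ (1 / 2 : ℝ) * Real.log N ^ 1 ≤ 1 / 20000 * N ∧
        3 * (N : ℝ) ^ (1 / 4 : ℝ) * Real.log N ^ 1 ≤ 1 / 20000 * N) ∧
      (N₁ ≤ N ∧ N₂ ≤ N) := by
    refine (?_ : ∀ᶠ N : ℕ in atTop, _).and
      (((GRHCalibration.eventually_rpow_mul_log_pow_le (by norm_num : (1 / 2 : ℝ) < 1) 1
          (by norm_num : (0 : ℝ) ≤ 3) (by norm_num : (0 : ℝ) < 1 / 20000)).and
        (GRHCalibration.eventually_rpow_mul_log_pow_le (by norm_num : (1 / 4 : ℝ) < 1) 1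
          (by norm_num : (0 : ℝ) ≤ 3) (by norm_num : (0 : ℝ) < 1 / 20000))).and
        ((eventually_ge_atTop N₁).and (eventually_ge_atTop N₂)))
    filter_upwards [Literature.NumberTheory.LFunctions.vonMangoldt_summatory_sub_isLittleO.def
      (by norm_num : (0 : ℝ) < 1 / 20000)] with N hN
    rw [Real.norm_eq_abs, Real.norm_of_nonneg (Nat.cast_nonneg N)] at hN
    obtain ⟨h1, h2⟩ := abs_le.mp hN
    constructor <;> linarith
  obtain ⟨N₀, hN₀⟩ := Filter.eventually_atTop.mp hev
  -- a Siegel zero of quality `η ≥ max η₂ (2Aθ₁/c)` at a conductor `q ≥ max q₂ (max N₀ 2)`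
  obtain ⟨q, inst, χ, η, hq, hη, hZ⟩ := hU (max η₂ (2 * A * θ₁ / c)) (max q₂ (max N₀ 2))
  have hq₂ : q₂ ≤ q := le_of_max_le_left hq
  have hqN₀ : N₀ ≤ q := le_of_max_le_left (le_of_max_le_right hq)
  have hq2 : 2 ≤ q := le_of_max_le_right (le_of_max_le_right hq)
  have hq0 : 0 < q := by omega
  have hq0r : (0 : ℝ) < q := by exact_mod_cast hq0
  have hη₂ : η₂ ≤ η := le_of_max_le_left hη
  have hηc : 2 * A * θ₁ ≤ c * η := by
    have := le_of_max_le_right hη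
    rw [div_le_iff₀ hc] at this
    linarith only [this, mul_comm c η]
  have hχ1 : χ ≠ 1 := Literature.NumberTheory.LFunctions.SiegelZeroQuality.ne_one_of_isPrimitive hZ.1 hq2
  have hρq1 : (1 : ℝ) ≤ (q : ℝ) / (Nat.totient q : ℝ) := pmt_one_le_div_totient hq0
  have hφq0 : (0 : ℝ) < (Nat.totient q : ℝ) := by exact_mod_cast Nat.totient_pos.mpr hq0
  have hφq : (Nat.totient q : ℝ) ≤ q := by exact_mod_cast Nat.totient_le q
  -- the endgame: character PNT for `χ` throughout `[q^A, q^{2A}]`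
  refine hE q χ η hZ hη₂ hq₂ (fun u hu1 hu2 => ?_)
  have hqu : q ≤ u := (Nat.le_self_pow hAne q).trans hu1
  have hN₀u : N₀ ≤ u := hqN₀.trans hqu
  obtain ⟨⟨hpnt1, hpnt2⟩, ⟨hsqrt, hquarter⟩, hN₁u, hN₂u⟩ := hN₀ u hN₀u
  simp only [pow_one] at hsqrt hquarter
  have hu1n : 1 ≤ u := by omega
  have hu0 : 0 < u := by omega
  have hu0r : (0 : ℝ) < u := by exact_mod_cast hu0
  have hu1r : (1 : ℝ) ≤ u := by exact_mod_cast hu1n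
  have hlogu : 0 ≤ Real.log u := Real.log_nonneg hu1r
  -- `q ≤ u^{1/A} ≤ u^{θ₁}, u^{1/4}`
  have hquA : (q : ℝ) ^ A ≤ u := by exact_mod_cast hu1
  have hqinv : (q : ℝ) ≤ (u : ℝ) ^ ((A : ℝ)⁻¹) := by
    have h := Real.rpow_le_rpow (by positivity) hquA (inv_nonneg.mpr hA0.le)
    rwa [Real.pow_rpow_inv_natCast hq0r.le hAne] at h
  have hAinvθ : (A : ℝ)⁻¹ ≤ θ₁ := by
    rw [inv_eq_one_div, div_le_iff₀ hA0]
    linarith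
  have hAinv4 : (A : ℝ)⁻¹ ≤ 1 / 4 := by
    rw [inv_eq_one_div, div_le_div_iff₀ hA0 (by norm_num : (0 : ℝ) < 4)]
    have : (4 : ℝ) ≤ A := by exact_mod_cast hA4
    linarith
  have hqθ : (q : ℝ) ≤ (u : ℝ) ^ θ₁ := hqinv.trans (Real.rpow_le_rpow_of_exponent_le hu1r hAinvθ)
  have hq4 : (q : ℝ) ≤ (u : ℝ) ^ (1 / 4 : ℝ) := hqinv.trans (Real.rpow_le_rpow_of_exponent_le hu1r hAinv4)
  -- the window `θ₁ log u ≤ c η log q` (`u ≤ q^{2A}`, `2Aθ₁ ≤ cη`)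
  have hwin : θ₁ * Real.log u ≤ c * η * Real.log q := by
    have hlogq : 0 ≤ Real.log q := Real.log_nonneg (by exact_mod_cast (show 1 ≤ q by omega))
    have hu2r : (u : ℝ) ≤ (q : ℝ) ^ (2 * A) := by exact_mod_cast hu2
    have hlog : Real.log u ≤ (2 * A : ℝ) * Real.log q := by
      have := Real.log_le_log hu0r hu2r
      rwa [Real.log_pow, Nat.cast_mul, Nat.cast_two] at this
    calc θ₁ * Real.log u ≤ θ₁ * ((2 * A : ℝ) * Real.log q) := mul_le_mul_of_nonneg_left hlog hθ₁.le
      _ = (2 * A * θ₁) * Real.log q := by ring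
      _ ≤ (c * η) * Real.log q := mul_le_mul_of_nonneg_right hηc hlogq
      _ = c * η * Real.log q := by ring
  -- the comparison modulus `d = ∏_{p ∣ q, p ≤ w} p`: `d ∣ q`, `d ≤ 4^w < q`, same prime divisors `≤ w`
  set w : ℕ := wlev (2 * A + 1) u with hw
  obtain ⟨d, hd⟩ : ∃ d : ℕ, d = ∏ p ∈ q.primeFactors.filter (fun p => p ≤ w), p := ⟨_, rfl⟩
  have hd0 : 0 < d := by
    rw [hd]
    exact Finset.prod_pos fun p hp => (Nat.prime_of_mem_primeFactors (Finset.mem_filter.mp hp).1).pos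
  have hdq : d ∣ q := by
    rw [hd]
    exact (Finset.prod_dvd_prod_of_subset _ _ _ (Finset.filter_subset _ _)).trans (Nat.prod_primeFactors_dvd q)
  have hd4w : d ≤ 4 ^ w := by
    rw [hd]
    calc ∏ p ∈ q.primeFactors.filter (fun p => p ≤ w), p ≤ ∏ p ∈ Nat.primesLE w, p :=
          Finset.prod_le_prod_of_subset_of_one_le'
            (fun p hp => Nat.mem_primesLE.mpr
              ⟨(Finset.mem_filter.mp hp).2, Nat.prime_of_mem_primeFactors (Finset.mem_filter.mp hp).1⟩)
            (fun p hp _ => (Nat.mem_primesLE.mp hp).2.one_le)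
      _ ≤ 4 ^ w := primorial_le_four_pow w
  have h4wu : (4 ^ w) ^ (2 * A + 1) ≤ u := by
    calc (4 ^ w) ^ (2 * A + 1) = 4 ^ (w * (2 * A + 1)) := (pow_mul 4 w (2 * A + 1)).symm
      _ ≤ 4 ^ Nat.log 4 u := Nat.pow_le_pow_right (by norm_num) (Nat.div_mul_le_self (Nat.log 4 u) (2 * A + 1))
      _ ≤ u := Nat.pow_log_le_self 4 (by omega)
  have hdltq : d < q := by
    by_contra hle
    push Not at hle
    have h1 : q ^ (2 * A + 1) ≤ u := le_trans (Nat.pow_le_pow_left (hle.trans hd4w) _) h4wu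
    have h2 : q ^ (2 * A) < q ^ (2 * A + 1) := Nat.pow_lt_pow_right (by omega) (by omega)
    exact absurd (h1.trans hu2) (not_le.mpr h2)
  have hnqd : ¬ q ∣ d := fun h => absurd (Nat.le_of_dvd hd0 h) (not_le.mpr hdltq)
  have hiff : ∀ p : ℕ, p.Prime → p ≤ wlev (2 * A + 1) u → (p ∣ q ↔ p ∣ d) := by
    intro p hp hpw
    refine ⟨fun hpq => ?_, fun hpd => hpd.trans hdq⟩
    rw [hd]
    exact Finset.dvd_prod_of_mem _ (Finset.mem_filter.mpr ⟨Nat.mem_primeFactors.mpr ⟨hp, hpq, by omega⟩, hpw⟩)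
  have hd1 : 1 ≤ d := hd0
  have hdqr : (d : ℝ) ≤ q := by exact_mod_cast Nat.le_of_dvd hq0 hdq
  have hdθ : (d : ℝ) ≤ (u : ℝ) ^ θ₁ := hdqr.trans hqθ
  have hd4 : (d : ℝ) ≤ (u : ℝ) ^ (1 / 4 : ℝ) := hdqr.trans hq4
  have hd0r : (0 : ℝ) < d := by exact_mod_cast hd0
  have hφd0 : (0 : ℝ) < (Nat.totient d : ℝ) := by exact_mod_cast Nat.totient_pos.mpr hd0
  have hρdq : (d : ℝ) / (Nat.totient d : ℝ) ≤ (q : ℝ) / (Nat.totient q : ℝ) :=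
    cast_div_totient_le_of_dvd hdq (by omega)
  -- (S) at the non-exceptional modulus `d`, and Gallagher's identity: `d · pairMass u d / u² ≤ (1+e) d/φ(d) + 2e`
  have hSd := hN₁ q χ η hZ u hN₁u hqθ hwin d hd1 hdθ hnqd
  have hGd := sum_classPsi_sq_eq_pairMass u d hd0
  have hΛ2 : 0 ≤ ∑ n ∈ Icc 1 u, Λ n ^ 2 := Finset.sum_nonneg fun _ _ => sq_nonneg _
  have hpMd : pairMass u d ≤ (1 + 1 / 20000) * ((u : ℝ) ^ 2 / (Nat.totient d : ℝ) + u * Real.log u) := by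
    linarith only [hSd, hGd, hΛ2]
  clear hN₁ hS hE hT hN₀ hev hU hP
  have hdlog : (d : ℝ) * Real.log u / u ≤ 1 / 20000 := by
    rw [div_le_iff₀ hu0r]
    have h1 : (d : ℝ) * Real.log u ≤ (u : ℝ) ^ (1 / 4 : ℝ) * Real.log u := mul_le_mul_of_nonneg_right hd4 hlogu
    have h2 : 0 ≤ (u : ℝ) ^ (1 / 4 : ℝ) * Real.log u := by positivity
    linarith only [h1, h2, hquarter]
  have hmassd : (d : ℝ) * pairMass u d / (u : ℝ) ^ 2 ≤
      (1 + 1 / 20000) * ((d : ℝ) / (Nat.totient d : ℝ)) + 2 / 20000 := by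
    have h1 : (d : ℝ) * pairMass u d / (u : ℝ) ^ 2 ≤
        (d : ℝ) * ((1 + 1 / 20000) * ((u : ℝ) ^ 2 / (Nat.totient d : ℝ) + u * Real.log u)) / (u : ℝ) ^ 2 :=
      div_le_div_of_nonneg_right (mul_le_mul_of_nonneg_left hpMd hd0r.le) (by positivity)
    have h2 : (d : ℝ) * ((1 + 1 / 20000) * ((u : ℝ) ^ 2 / (Nat.totient d : ℝ) + u * Real.log u)) / (u : ℝ) ^ 2 =
        (1 + 1 / 20000) * ((d : ℝ) / (Nat.totient d : ℝ)) + (1 + 1 / 20000) * ((d : ℝ) * Real.log u / u) := by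
      field_simp
    rw [h2] at h1
    have h3 : 0 ≤ (d : ℝ) * Real.log u / u := by positivity
    linarith only [h1, h3, hdlog]
  -- (T): transfer to the exceptional modulus `q`: `pairMass u q ≤ (1 + 5e) u²/φ(q)`
  have hTr := hN₂ u hN₂u q d hq0 hd1 hq4 hd4 hiff
  have hmassq : (q : ℝ) * pairMass u q / (u : ℝ) ^ 2 ≤ (1 + 5 / 20000) * ((q : ℝ) / (Nat.totient q : ℝ)) := by
    have h1 := (abs_le.mp hTr).2
    linarith only [h1, hmassd, hρdq, hρq1]
  clear hN₂ hTr
  have hpMq : pairMass u q ≤ (1 + 5 / 20000) * (u : ℝ) ^ 2 / (Nat.totient q : ℝ) := by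
    have h1 : (q : ℝ) * pairMass u q ≤ (1 + 5 / 20000) * ((q : ℝ) / (Nat.totient q : ℝ)) * (u : ℝ) ^ 2 :=
      (div_le_iff₀ (by positivity)).mp hmassq
    have h2 : (1 + 5 / 20000) * ((q : ℝ) / (Nat.totient q : ℝ)) * (u : ℝ) ^ 2 =
        (q : ℝ) * ((1 + 5 / 20000) * (u : ℝ) ^ 2 / (Nat.totient q : ℝ)) := by
      field_simp
    rw [h2] at h1
    exact le_of_mul_le_mul_left h1 hq0r
  -- Gallagher at `q`, Parseval (P), PNT: `‖ψ(u, χ)‖² ≤ 10 e u² ≤ (u/40)²`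
  have hGq := sum_classPsi_sq_eq_pairMass u q hq0
  have hΛ2le := sum_vonMangoldt_sq_le_log_mul u
  have hPar := stub_excParsevalLower q χ hχ1 u
  have hsplit := Finset.sum_filter_add_sum_filter_not (Icc 1 u) (fun n => n.Coprime q) (fun n => (Λ n : ℝ))
  have hSnc : ∑ n ∈ (Icc 1 u).filter (fun n => ¬ n.Coprime q), Λ n ≤ 1 / 20000 * u := by
    have h1 := GRHCalibration.sum_not_coprime_vonMangoldt_le (q := q) hu1n hqu
    rw [Real.sqrt_eq_rpow] at h1
    linarith only [h1, hsqrt]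
  have hScop_ge : (1 - 2 / 20000) * u ≤ ∑ n ∈ (Icc 1 u).filter (fun n => n.Coprime q), Λ n := by
    linarith only [hsplit, hSnc, hpnt1]
  have hScop2 : (1 - 4 / 20000) * (u : ℝ) ^ 2 ≤ (∑ n ∈ (Icc 1 u).filter (fun n => n.Coprime q), Λ n) ^ 2 := by
    have h0 : (0 : ℝ) ≤ (1 - 2 / 20000) * u := by positivity
    have h1 : ((1 - 2 / 20000) * u) ^ 2 ≤ (∑ n ∈ (Icc 1 u).filter (fun n => n.Coprime q), Λ n) ^ 2 :=
      pow_le_pow_left₀ h0 hScop_ge 2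
    have h2 : (1 - 4 / 20000) * (u : ℝ) ^ 2 ≤ ((1 - 2 / 20000) * u) ^ 2 := by
      rw [mul_pow]
      exact mul_le_mul_of_nonneg_right (by norm_num) (sq_nonneg _)
    exact h2.trans h1
  have hΛ2u : (Nat.totient q : ℝ) * ∑ n ∈ Icc 1 u, Λ n ^ 2 ≤ 1 / 20000 * (u : ℝ) ^ 2 := by
    have h1 : ∑ n ∈ Icc 1 u, Λ n ^ 2 ≤ Real.log u * ((1 + 1 / 20000) * u) :=
      hΛ2le.trans (mul_le_mul_of_nonneg_left hpnt2 hlogu)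
    have h2 : (Nat.totient q : ℝ) ≤ (u : ℝ) ^ (1 / 4 : ℝ) := hφq.trans hq4
    calc (Nat.totient q : ℝ) * ∑ n ∈ Icc 1 u, Λ n ^ 2
        ≤ (u : ℝ) ^ (1 / 4 : ℝ) * (Real.log u * ((1 + 1 / 20000) * u)) :=
          mul_le_mul h2 h1 hΛ2 (by positivity)
      _ ≤ (u : ℝ) ^ (1 / 4 : ℝ) * (Real.log u * (3 * u)) := by gcongr; norm_num
      _ = (3 * (u : ℝ) ^ (1 / 4 : ℝ) * Real.log u) * u := by ring
      _ ≤ (1 / 20000 * u) * u := mul_le_mul_of_nonneg_right hquarter hu0r.le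
      _ = 1 / 20000 * (u : ℝ) ^ 2 := by ring
  have hφpM : (Nat.totient q : ℝ) * pairMass u q ≤ (1 + 5 / 20000) * (u : ℝ) ^ 2 := by
    calc (Nat.totient q : ℝ) * pairMass u q
        ≤ (Nat.totient q : ℝ) * ((1 + 5 / 20000) * (u : ℝ) ^ 2 / (Nat.totient q : ℝ)) :=
          mul_le_mul_of_nonneg_left hpMq hφq0.le
      _ = (1 + 5 / 20000) * (u : ℝ) ^ 2 := by field_simp
  have htot : (Nat.totient q : ℝ) * ∑ a ∈ Finset.range q, classPsi u q a ^ 2 ≤ (1 + 6 / 20000) * (u : ℝ) ^ 2 := by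
    rw [hGq, mul_add]
    linarith only [hΛ2u, hφpM]
  have hT2 : ‖charPsi χ u‖ ^ 2 ≤ ((u : ℝ) / 40) ^ 2 := by
    have h40 : ((u : ℝ) / 40) ^ 2 = (u : ℝ) ^ 2 / 1600 := by ring
    rw [h40]
    linarith only [hPar, htot, hScop2, sq_nonneg (u : ℝ)]
  exact (pow_le_pow_iff_left₀ (norm_nonneg _) (by positivity) two_ne_zero).mp hT2

/-- **The bare parity atom implies rh.S34**, debt-free: `IncidenceBandlimitedCoreDecay θ → NoSiegelZeros` for every
`θ > 0` (B′ + the PROVED `noSiegelZeros_of_not_unboundedSiegelZeros`). Supersedes `noSiegelZeros_of_core` (modulo MM). -/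
theorem noSiegelZeros_of_coreDecay_free {θ : ℝ} (hθ0 : 0 < θ) (hP : IncidenceBandlimitedCoreDecay θ) :
    Literature.NumberTheory.LFunctions.NoSiegelZeros :=
  noSiegelZeros_of_not_unboundedSiegelZeros (siegelRepulsion_free θ hθ0 hP)

/-! ### Consequences: rh.S34 from the atom, the debt-free calibration, hardness certificates -/

/-- **THE LINE, DEBT-FREE**: `0 < θ → θ < 1 → IncidenceBandlimitedCoreDecay θ → RelativeDimOne` — B′ feeds rh.S34 into the
landed sufficiency half `relativeDimOne_of_core_of_noSiegelZeros` (A, C1, C2, C3 by name). No stub, no vendored fact. -/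
theorem relativeDimOne_of_coreDecay_free {θ : ℝ} (hθ0 : 0 < θ) (hθ1 : θ < 1) (hP : IncidenceBandlimitedCoreDecay θ) :
    RelativeDimOne :=
  relativeDimOne_of_core_of_noSiegelZeros (noSiegelZeros_of_coreDecay_free hθ0 hP) hθ0 hθ1 hP

/-- **THE CALIBRATION, DEBT-FREE** — the crux IS its parity atom: `RelativeDimOne ↔ IncidenceBandlimitedCoreDecay (1/4)`
(`→` the landed `coreDecay_of_relativeDimOne`; `←` the line). Supersedes `relativeDimOne_iff_core` (p129131, modulo MM) and
closes the gap of `relativeDimOne_iff_core_of_coreImpliesNSZ` (c4): the residual of stmt-Parity-14113 is ONE typed statement,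
with no literature debt. -/
theorem relativeDimOne_iff_core_free :
    Summit.Parity.GeneralizedHardyLittlewood.Theses.LeeYangFibres.RelativeDimOne ↔ IncidenceBandlimitedCoreDecay (1 / 4) :=
  relativeDimOne_iff_core_of_coreImpliesNSZ fun hP => noSiegelZeros_of_coreDecay_free (by norm_num) hP

/-- The debt-free calibration at every level `0 < θ < 1`: all the `IncidenceBandlimitedCoreDecay θ`, `0 < θ < 1`, are
equivalent to each other and to the crux. -/
theorem relativeDimOne_iff_core_free_at {θ : ℝ} (hθ0 : 0 < θ) (hθ1 : θ < 1) :
    RelativeDimOne ↔ IncidenceBandlimitedCoreDecay θ :=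
  ⟨coreDecay_of_relativeDimOne hθ0, relativeDimOne_of_coreDecay_free hθ0 hθ1⟩

/-- **The parity atom carries the whole `L`-content of the crux**, debt-free: it implies the fixed-level `L`-atom
`LowClassSecondMoment θ₁` at every level `θ₁ ≤ 1`. -/
theorem lowClassSecondMoment_of_coreDecay_free {θ₁ : ℝ} (hθ₁ : θ₁ ≤ 1) (hP : IncidenceBandlimitedCoreDecay (1 / 4)) :
    LowClassSecondMoment θ₁ :=
  lowClassSecondMoment_of_relativeDimOne hθ₁ (relativeDimOne_iff_core_free.mpr hP)

/-- … and uniform character PNT to conductor `N^θ`, every `θ < 1` (`uniformCharPNT_of_relativeDimOne`, p92834). -/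
theorem uniformCharPNT_of_coreDecay_free (hP : IncidenceBandlimitedCoreDecay (1 / 4)) : UniformCharPNT :=
  uniformCharPNT_of_relativeDimOne (relativeDimOne_iff_core_free.mpr hP)

/-- **Hardness certificate for every line feeding P′** (cruxes 14108 / 14109 / 14113): Siegel zeros of unbounded quality
refute the parity atom at every level `θ > 0` — any sufficient stub set for P′ proves `¬UnboundedSiegelZeros`. -/
theorem not_coreDecay_of_unboundedSiegelZeros (hU : UnboundedSiegelZeros) {θ : ℝ} (hθ0 : 0 < θ) :
    ¬ IncidenceBandlimitedCoreDecay θ :=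
  fun hP => siegelRepulsion_free θ hθ0 hP hU

end Summit.Parity.GeneralizedHardyLittlewood.Cruxes.RelativeDimOne.FloatingLevelCore

end
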